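import Literature.Barriers.Parity.SiegelZeroDichotomyPairHLProp71ii
import Literature.Barriers.Parity.SiegelZeroDichotomyChowlaStep3Model
import Mathlib.NumberTheory.Harmonic.Bounds
import HarnessLib

/-!
# Tao–Teräväinen 2022, Proposition 7.2 (`k = 2`): tools

Topic `Literature/Barriers/Parity`, sub-namespace `TaoTeravainen`; a tool file of the proof DAG of
`Literature.Barriers.Parity.TaoTeravainen2021_prop72_81_pair` (T. Tao, J. Teräväinen, *The
Hardy–Littlewood–Chowla conjecture in the presence of a Siegel zero*, J. London Math. Soc. (2) 106
(2022), arXiv:2109.06291), proof of Proposition 7.2: "From (2.16) and summation by parts, it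
suffices to show … where `a_{d̃_j} ≪ x^{ε²}` are coefficients … `∑ 1/[d₂,d̃₂,…] ≪ x^ε`".
Everything here is PROVED:

* `sum_Icc_mul_eq_abel_partial` / `abs_sum_Icc_mul_le_abel` — Abel summation by parts on `[lo, hi]`:
  `|∑ c(N) W(N)| ≤ (max |partial sums of c|)·(|W(hi)| + ∑ |W(N) - W(N+1)|)`;
* `abs_logBump_sub_le`, `sum_abs_logBump_sub_le` — the total variation of
  `N ↦ Φ_t(N) = φ(log N - v)` along the integers is `≤ 17 sup|φ'|` once `e^{v-1} ≥ 2`;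
* `sum_gcd_div_le_log`, `sum_inv_lcm_le` — `∑_{d ≤ Y} 1/[d, D] ≤ τ(D)(1 + log Y)/D`;
* `intChar` (`k ↦ Re χ(k mod q)` on `ℤ`, `q`-periodic, `1`-bounded) with `intChar_natCast`.
  [cite: TaoTeravainen2021, proof of Proposition 7.2]
-/

noncomputable section

open Finset Real
open scoped ContDiff Topology

namespace Literature.Barriers.Parity

namespace TaoTeravainen

open Literature.Analysis.Calculus

/-! ### Abel summation -/

/-- **Abel summation** on `[lo, hi]` (`lo ≤ hi`): with `A(N') = ∑_{lo ≤ N ≤ N'} c(N)`,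
`∑_{lo ≤ N ≤ hi} c(N) W(N) = A(hi) W(hi) + ∑_{lo ≤ N < hi} A(N) (W(N) - W(N+1))`. [folklore] -/
theorem sum_Icc_mul_eq_abel_partial (c W : ℕ → ℝ) {lo hi : ℕ} (h : lo ≤ hi) :
    ∑ N ∈ Icc lo hi, c N * W N =
      (∑ N ∈ Icc lo hi, c N) * W hi +
        ∑ N ∈ Ico lo hi, (∑ k ∈ Icc lo N, c k) * (W N - W (N + 1)) := by
  induction hi, h using Nat.le_induction with
  | base => simp
  | succ hi hle ih =>
    rw [Finset.sum_Icc_succ_top (Nat.le_succ_of_le hle), ih, Finset.sum_Icc_succ_top (Nat.le_succ_of_le hle),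
      Finset.sum_Ico_succ_top hle]
    ring

/-- **Abel's inequality**: if all partial sums `|A(N')| ≤ M` (`lo ≤ N' ≤ hi`), then
`|∑_{lo ≤ N ≤ hi} c(N) W(N)| ≤ M (|W(hi)| + ∑_{lo ≤ N < hi} |W(N) - W(N+1)|)` ("(2.16) and summation
by parts"). [cite: TaoTeravainen2021, proof of Proposition 7.2] -/
theorem abs_sum_Icc_mul_le_abel (c W : ℕ → ℝ) {lo hi : ℕ} {M : ℝ} (hM : 0 ≤ M)
    (hA : ∀ N' ∈ Icc lo hi, |∑ k ∈ Icc lo N', c k| ≤ M) :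
    |∑ N ∈ Icc lo hi, c N * W N| ≤ M * (|W hi| + ∑ N ∈ Ico lo hi, |W N - W (N + 1)|) := by
  rcases lt_or_ge hi lo with h | h
  · rw [Finset.Icc_eq_empty (by omega), sum_empty, abs_zero]
    positivity
  rw [sum_Icc_mul_eq_abel_partial c W h]
  refine (abs_add_le _ _).trans ?_
  rw [mul_add, mul_sum]
  refine add_le_add ?_ ((abs_sum_le_sum_abs _ _).trans (sum_le_sum fun N hN => ?_))
  · rw [abs_mul]; exact mul_le_mul_of_nonneg_right (hA hi (by rw [mem_Icc]; omega)) (abs_nonneg _)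
  · rw [mem_Ico] at hN
    rw [abs_mul]
    exact mul_le_mul_of_nonneg_right (hA N (by rw [mem_Icc]; omega)) (abs_nonneg _)

/-! ### The variation of `Φ_t` along the integers -/

/-- `|Φ_t(m) - Φ_t(m+1)| ≤ sup|φ'|/m`, and `= 0` unless `[m, m+1]` meets `[t/e, et]` (`m ≥ 1`).
[folklore] -/
theorem abs_logBump_sub_le {φ : ℝ → ℝ} (hφ : IsBump φ) {B₁ : ℝ} (hB₁ : ∀ u, |deriv φ u| ≤ B₁)
    (v : ℝ) {m : ℕ} (hm : 1 ≤ m) :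
    |logBump φ v m - logBump φ v (m + 1)| ≤
      if Real.exp (v - 1) ≤ (m : ℝ) + 1 ∧ (m : ℝ) ≤ Real.exp (v + 1) then B₁ / m else 0 := by
  have hB0 : 0 ≤ B₁ := (abs_nonneg _).trans (hB₁ 0)
  have hm0 : (0 : ℝ) < m := by exact_mod_cast hm
  have hdiff : Differentiable ℝ (logBump φ v) := (contDiff_logBump hφ v).differentiable (by simp)
  -- the derivative bound on `[m, m+1]`
  have hder : ∀ y ∈ Set.Icc (m : ℝ) (m + 1), ‖deriv (logBump φ v) y‖ ≤
      if Real.exp (v - 1) ≤ (m : ℝ) + 1 ∧ (m : ℝ) ≤ Real.exp (v + 1) then B₁ / m else 0 := by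
    intro y hy
    have hy0 : 0 < y := lt_of_lt_of_le hm0 hy.1
    rw [show deriv (logBump φ v) y = logBumpDeriv φ v y from rfl]
    split_ifs with hcase
    · rw [logBumpDeriv_eq hφ v hy0, Real.norm_eq_abs, abs_div, abs_of_pos hy0]
      calc |deriv φ (Real.log y - v)| / y ≤ B₁ / y := div_le_div_of_nonneg_right (hB₁ _) hy0.le
        _ ≤ B₁ / m := div_le_div_of_nonneg_left hB0 hm0 hy.1
    · rw [not_and_or, not_le, not_le] at hcase
      rw [logBumpDeriv_eq_zero hφ ?_, norm_zero]
      rcases hcase with hc | hc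
      · left; linarith [hy.2]
      · right; linarith [hy.1]
  have h := Convex.norm_image_sub_le_of_norm_deriv_le (fun y _ => hdiff.differentiableAt) hder
    (convex_Icc _ _) (Set.left_mem_Icc.mpr (by linarith)) (Set.right_mem_Icc.mpr (by linarith))
  rw [Real.norm_eq_abs, Real.norm_eq_abs, show (m : ℝ) + 1 - m = 1 by ring, abs_one, mul_one] at h
  rw [abs_sub_comm]
  exact_mod_cast h

/-- **The total variation of `Φ_t` along the integers**: for `e^{v-1} ≥ 2`,
`∑_{m ∈ [1, K]} |Φ_t(m) - Φ_t(m+1)| ≤ 17 sup|φ'|`. [folklore] -/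
theorem sum_abs_logBump_sub_le {φ : ℝ → ℝ} (hφ : IsBump φ) {B₁ : ℝ} (hB₁ : ∀ u, |deriv φ u| ≤ B₁)
    {v : ℝ} (hv : 2 ≤ Real.exp (v - 1)) (K : ℕ) :
    ∑ m ∈ Icc 1 K, |logBump φ v m - logBump φ v (m + 1)| ≤ 17 * B₁ := by
  have hB0 : 0 ≤ B₁ := (abs_nonneg _).trans (hB₁ 0)
  set y₀ : ℝ := Real.exp (v - 1) with hy₀
  have hy₁ : Real.exp (v + 1) = Real.exp 2 * y₀ := by rw [hy₀, ← Real.exp_add]; congr 1; ring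
  have he2 : Real.exp 2 ≤ 8 := by
    have h1 : Real.exp 1 ≤ 2.72 := by have := Real.exp_one_lt_d9; linarith
    have : Real.exp 2 = Real.exp 1 * Real.exp 1 := by rw [← Real.exp_add]; norm_num
    rw [this]; nlinarith [Real.exp_pos 1]
  -- the window of `m` that can contribute
  set lo : ℕ := ⌈y₀⌉₊ - 1 with hlo
  set hi : ℕ := ⌊Real.exp 2 * y₀⌋₊ with hhi
  have hlo1 : 1 ≤ lo := by
    have : 2 ≤ ⌈y₀⌉₊ := by
      have h := Nat.le_ceil y₀
      have : (2 : ℝ) ≤ ⌈y₀⌉₊ := hv.trans h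
      exact_mod_cast this
    omega
  have hlor : y₀ - 1 ≤ (lo : ℝ) := by
    rw [hlo, Nat.cast_sub (by omega), Nat.cast_one]
    linarith [Nat.le_ceil y₀]
  have hlor' : (lo : ℝ) ≤ y₀ := by
    rw [hlo, Nat.cast_sub (by omega), Nat.cast_one]
    linarith [Nat.ceil_lt_add_one (show 0 ≤ y₀ by positivity)]
  have hterm : ∀ m ∈ Icc 1 K, |logBump φ v m - logBump φ v (m + 1)| ≤
      if lo ≤ m ∧ m ≤ hi then B₁ / lo else 0 := by
    intro m hm
    rw [mem_Icc] at hm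
    refine (abs_logBump_sub_le hφ hB₁ v hm.1).trans ?_
    rw [hy₁]
    split_ifs with h1 h2 h2
    · exact div_le_div_of_nonneg_left hB0 (by exact_mod_cast hlo1) (by exact_mod_cast h2.1)
    · exfalso; apply h2
      constructor
      · -- `y₀ ≤ m + 1` gives `⌈y₀⌉ ≤ m + 1`
        have : ⌈y₀⌉₊ ≤ m + 1 := Nat.ceil_le.mpr (by exact_mod_cast h1.1)
        omega
      · exact Nat.le_floor h1.2
    · positivity
    · exact le_rfl
  refine (sum_le_sum hterm).trans ?_
  rw [← sum_filter]
  have hsub : (Icc 1 K).filter (fun m => lo ≤ m ∧ m ≤ hi) ⊆ Icc lo hi := by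
    intro m hm; rw [mem_filter, mem_Icc] at hm; rw [mem_Icc]; exact hm.2
  calc ∑ m ∈ (Icc 1 K).filter (fun m => lo ≤ m ∧ m ≤ hi), B₁ / lo
      ≤ ∑ m ∈ Icc lo hi, B₁ / lo := sum_le_sum_of_subset_of_nonneg hsub fun _ _ _ => by positivity
    _ = ((hi + 1 - lo : ℕ) : ℝ) * (B₁ / lo) := by rw [sum_const, Nat.card_Icc, nsmul_eq_mul]
    _ ≤ 17 * B₁ := by
        have hlo0 : (0 : ℝ) < lo := by exact_mod_cast hlo1
        have hcount : ((hi + 1 - lo : ℕ) : ℝ) ≤ 17 * lo := by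
          have h1 : ((hi + 1 - lo : ℕ) : ℝ) ≤ (hi : ℝ) + 1 := by
            have : hi + 1 - lo ≤ hi + 1 := Nat.sub_le _ _
            exact_mod_cast this
          have hy0 : 0 ≤ y₀ := by positivity
          have h2 : (hi : ℝ) ≤ 8 * y₀ :=
            (Nat.floor_le (by positivity)).trans (mul_le_mul_of_nonneg_right he2 hy0)
          -- `hi + 1 ≤ 8 y₀ + 1 ≤ 17 (y₀ - 1) ≤ 17 lo` since `y₀ ≥ 2`
          linarith [hlor, hv, h1, h2]
        calc ((hi + 1 - lo : ℕ) : ℝ) * (B₁ / lo) ≤ (17 * lo) * (B₁ / lo) :=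
              mul_le_mul_of_nonneg_right hcount (by positivity)
          _ = 17 * B₁ := by field_simp

/-! ### Sums of `1/[d, D]` -/

/-- `∑_{1 ≤ b ≤ Y} (b, D)/b ≤ τ(D) (1 + log Y)` for `D ≥ 1`. [cite: TaoTeravainen2021, proof of
Proposition 7.2 ("`∑ 1/[d₂,…,d̃_k] ≪ x^ε`")] -/
theorem sum_gcd_div_le_log {D : ℕ} (hD : 0 < D) (Y : ℕ) :
    ∑ b ∈ Icc 1 Y, ((Nat.gcd b D : ℕ) : ℝ) / b ≤ (Nat.divisors D).card * (1 + Real.log Y) := by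
  rcases Nat.eq_zero_or_pos Y with rfl | hY
  · simp
  have hgcd : ∀ b ∈ Icc 1 Y, ((Nat.gcd b D : ℕ) : ℝ) / b ≤
      ∑ d ∈ Nat.divisors D, if d ∣ b then (d : ℝ) / b else 0 := by
    intro b hb
    rw [← sum_filter]
    have hmem : Nat.gcd b D ∈ (Nat.divisors D).filter (fun d => d ∣ b) := by
      rw [mem_filter, Nat.mem_divisors]
      exact ⟨⟨Nat.gcd_dvd_right _ _, hD.ne'⟩, Nat.gcd_dvd_left _ _⟩
    exact Finset.single_le_sum (s := (Nat.divisors D).filter (fun d => d ∣ b)) (f := fun d : ℕ => (d : ℝ) / b)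
      (fun d _ => div_nonneg (Nat.cast_nonneg d) (Nat.cast_nonneg b)) hmem
  refine (sum_le_sum hgcd).trans ?_
  rw [sum_comm]
  have hinner : ∀ d ∈ Nat.divisors D, ∑ b ∈ Icc 1 Y, (if d ∣ b then (d : ℝ) / b else 0) ≤ 1 + Real.log Y := by
    intro d hd
    have hd0 : 0 < d := Nat.pos_of_mem_divisors hd
    rw [← sum_filter]
    -- reindex `b = d k`, `1 ≤ k ≤ Y / d`
    have hset : (Icc 1 Y).filter (fun b => d ∣ b) = (Icc 1 (Y / d)).image (fun k => d * k) := by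
      ext b
      simp only [mem_filter, mem_Icc, mem_image]
      constructor
      · rintro ⟨⟨hb1, hbY⟩, k, hk⟩
        refine ⟨k, ⟨?_, ?_⟩, hk.symm⟩
        · exact Nat.pos_of_ne_zero fun h => by rw [h, mul_zero] at hk; omega
        · rw [Nat.le_div_iff_mul_le hd0, mul_comm]; omega
      · rintro ⟨k, ⟨hk1, hkY⟩, rfl⟩
        refine ⟨⟨Nat.mul_pos hd0 hk1, ?_⟩, Dvd.intro _ rfl⟩
        have := (Nat.le_div_iff_mul_le hd0).mp hkY
        rw [mul_comm]; exact this
    have hle : ∑ b ∈ (Icc 1 Y).filter (fun b => d ∣ b), (d : ℝ) / b ≤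
        ∑ k ∈ Icc 1 (Y / d), (1 : ℝ) / k := by
      rw [hset, sum_image (fun k _ k' _ h => Nat.eq_of_mul_eq_mul_left hd0 h)]
      refine le_of_eq (sum_congr rfl fun k hk => ?_)
      rw [mem_Icc] at hk
      have hk0 : (0 : ℝ) < k := by exact_mod_cast hk.1
      have hd0' : (0 : ℝ) < d := by exact_mod_cast hd0
      push_cast
      field_simp
    refine hle.trans ?_
    have hharm : ∑ k ∈ Icc 1 (Y / d), (1 : ℝ) / k ≤ 1 + Real.log Y := by
      have h1 : ∑ k ∈ Icc 1 (Y / d), (1 : ℝ) / k = (harmonic (Y / d) : ℝ) := by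
        rw [harmonic_eq_sum_Icc]; push_cast
        refine sum_congr rfl fun k _ => ?_; simp
      rw [h1]
      rcases Nat.eq_zero_or_pos (Y / d) with h0 | h0
      · rw [h0, harmonic_zero]; push_cast
        linarith [Real.log_nonneg (show (1 : ℝ) ≤ Y by exact_mod_cast hY)]
      · calc (harmonic (Y / d) : ℝ) ≤ 1 + Real.log (Y / d : ℕ) := harmonic_le_one_add_log _
          _ ≤ 1 + Real.log Y := by
              have h0' : (0 : ℝ) < (Y / d : ℕ) := by exact_mod_cast h0
              have hle' : ((Y / d : ℕ) : ℝ) ≤ Y := by exact_mod_cast Nat.div_le_self Y d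
              linarith [Real.log_le_log h0' hle']
    exact hharm
  calc ∑ d ∈ Nat.divisors D, ∑ b ∈ Icc 1 Y, (if d ∣ b then (d : ℝ) / b else 0)
      ≤ ∑ _d ∈ Nat.divisors D, (1 + Real.log Y) := sum_le_sum hinner
    _ = (Nat.divisors D).card * (1 + Real.log Y) := by rw [sum_const, nsmul_eq_mul]

/-- `∑_{1 ≤ d ≤ Y} 1/[d, D] ≤ τ(D)(1 + log Y)/D ≤ 1 + log Y` (using `τ(D) ≤ D`).
[cite: TaoTeravainen2021, proof of Proposition 7.2] -/
theorem sum_inv_lcm_le {D : ℕ} (hD : 0 < D) (Y : ℕ) :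
    ∑ d ∈ Icc 1 Y, (1 : ℝ) / Nat.lcm d D ≤ 1 + Real.log Y := by
  have h1 : ∀ d ∈ Icc 1 Y, (1 : ℝ) / Nat.lcm d D = (1 / D) * (((Nat.gcd d D : ℕ) : ℝ) / d) := by
    intro d hd
    rw [mem_Icc] at hd
    have hd0 : (0 : ℝ) < d := by exact_mod_cast hd.1
    have hD0 : (0 : ℝ) < D := by exact_mod_cast hD
    have hl : ((Nat.lcm d D : ℕ) : ℝ) * (Nat.gcd d D : ℕ) = (d : ℝ) * D := by
      rw [mul_comm]; exact_mod_cast Nat.gcd_mul_lcm d D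
    have hl0 : (0 : ℝ) < Nat.lcm d D := by exact_mod_cast Nat.lcm_pos hd.1 hD
    have hg0 : (0 : ℝ) < Nat.gcd d D := by exact_mod_cast Nat.gcd_pos_of_pos_left _ hd.1
    field_simp
    linarith [hl]
  rw [sum_congr rfl h1, ← mul_sum]
  have h2 := sum_gcd_div_le_log hD Y
  have hlog : 0 ≤ 1 + Real.log Y := by
    rcases Nat.eq_zero_or_pos Y with rfl | hY
    · simp
    · linarith [Real.log_nonneg (show (1 : ℝ) ≤ Y by exact_mod_cast hY)]
  have hτ : ((Nat.divisors D).card : ℝ) ≤ D := by exact_mod_cast Nat.card_divisors_le_self D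
  have hD0 : (0 : ℝ) < D := by exact_mod_cast hD
  calc (1 / (D : ℝ)) * ∑ d ∈ Icc 1 Y, ((Nat.gcd d D : ℕ) : ℝ) / d
      ≤ (1 / (D : ℝ)) * ((Nat.divisors D).card * (1 + Real.log Y)) :=
        mul_le_mul_of_nonneg_left h2 (by positivity)
    _ ≤ (1 / (D : ℝ)) * (D * (1 + Real.log Y)) := by gcongr
    _ = 1 + Real.log Y := by field_simp

/-! ### `χ` on the integers -/

variable {q : ℕ}

/-- `χ` pulled back to `ℤ`: `k ↦ Re χ(k mod q)`. [folklore] -/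
def intChar (χ : DirichletCharacter ℂ q) (k : ℤ) : ℝ := (χ (k : ZMod q)).re

/-- `|intChar| ≤ 1`. [folklore] -/
theorem abs_intChar_le_one (χ : DirichletCharacter ℂ q) (k : ℤ) : |intChar χ k| ≤ 1 :=
  (Complex.abs_re_le_norm _).trans (χ.norm_le_one _)

/-- `intChar` is `q`-periodic. [folklore] -/
theorem intChar_add_natCast (χ : DirichletCharacter ℂ q) (k : ℤ) : intChar χ (k + q) = intChar χ k := by
  unfold intChar; push_cast; simp

/-- `intChar` agrees with `realChar` on natural numbers. [folklore] -/
theorem intChar_natCast (χ : DirichletCharacter ℂ q) (n : ℕ) : intChar χ (n : ℤ) = realChar χ n := by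
  unfold intChar realChar; push_cast; rfl

end TaoTeravainen

end Literature.Barriers.Parity
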